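import Summits.AtomisticToContinuum.HydrodynamicLimit.Theorems.AntiMazurCoboundariesInfluenceLocalityForecastCapsExistPrelim
import Summits.AtomisticToContinuum.HydrodynamicLimit.Theorems.AntiMazurCoboundariesInfluenceLocalityForecastWorldsGood

/-!
# Stub `stub_forecastCapsExist` (line `slab-percolation-shadow`, crux `InfluenceLocality`,
# stmt-AtomisticToContinuum-13916; route AntiMazurCoboundaries): the stub is EQUIVALENT to one
# named cluster-cardinality tail

The registered stub `stub_forecastCapsExist : ForecastCapsExist` (the forecast-side cap `G_free`)
is NOT proved here. This file closes the bookkeeping around it, so that the remaining gap of the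
line is exactly ONE named proposition with no existential over schedules:

* `gibbs_not_forecastGood`: bad forecasts are `G_N`-null for ALL parameters (stub 1 of the dead
  line in its `S`-uniform form `ae_gibbs_mem_good_and_restrictTo_mem_good`; no positivity needed);
* `gibbs_isGathering_eq_isCrowded`: hence, for `0 ≤ T`, the gathering event of the objects module
  and the grid-free crowding event of the prelim have the SAME `G_N`-probability
  (`isGathering_iff_isCrowded` on good forecasts), and the two tails agree schedule by schedule
  (`forecastGatheringTail_iff_clusterCardTail`);
* `forecastCapsExist_iff_sqrtClusterCardTail`: `ForecastCapsExist` is EQUIVALENT to its own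
  quantifier shell around the cluster-cardinality tail `ForecastClusterCardTail σ a θ u₀ T ⌊√·⌋₊`
  AT THE CANONICAL SCHEDULE `M(R) = ⌊√R⌋₊` (the largest admissible one; crowding is antitone in
  the threshold, `ForecastClusterCardTail.mono`) — no existential over schedules is left — with
  the one-way corollaries `forecastCapsExist_of_clusterCardTail` (named reduction) and
  `forecastCapsExist_of_clusterCardTail_half` (per-parameter form, `σ₀ = 1/2`); restated on one
  line as the registered sub-goal `stub_forecastCapsExist_reduction`.

Status of the remaining Prop (numbers, for the lead): `ForecastClusterCardTail σ a θ u₀ T ⌊√·⌋₊`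
asks that, for the ISOLATED range-`Rℓ` droplet (`≈ 4.19 R³` spheres of reduced diameter `σ`,
Gibbs data, released into vacuum for the microscopic time `Tℓ`, i.e. `≈ 2√π σ² √θ T` mean free
times per particle — unbounded, since `σ₀` is chosen before `T`), the probability that SOME member
has a backward cluster of `≥ ⌊√R⌋₊` particles is `o(1)` as `R → ∞`, uniformly in `N ≥ N₀(R)`.
The law of the released droplet is not stationary for the cluster flow; the tree-expansion
(Lanford) bound on `P(|BC| ≥ M)` is `Σ_{n ≥ M} (C λT)^n`, useless once `C λT ≥ 1`; no result in
print controls backward-cluster cardinalities at fixed reduced density beyond that window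
(Pulvirenti–Simonella-type tails are Boltzmann–Grad statements). The Prop disappears under a
walled / frozen-exterior re-typing of the forecast (lead's `PICKED.md`).
-/

namespace Summit.AtomisticToContinuum.HydrodynamicLimit.Theorems.TrueAnchoredInfection

open MeasureTheory Set
open scoped ENNReal
open Literature.Analysis.FluidPDE Literature.MathematicalPhysics.KineticTheory

noncomputable section

/-! ## Bad forecasts are null; gathering and crowding have the same probability -/

/-- Bad forecasts are `G_N`-null: for every range, flow, cluster-flow family and particle,
`G_N`-almost every datum is a good forecast (no hypothesis on the parameters). -/
theorem ae_forecastGood (σ a θ : ℝ) (u₀ : V3) (R : ℝ) (N : ℕ) (Φ : Flow σ N)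
    (Ψ : ClusterFlows σ N) (i : Fin (N + 1)) :
    ∀ᵐ z ∂(gibbs σ a θ u₀ N Φ), ForecastGood σ R N Ψ z i := by
  filter_upwards [ae_gibbs_mem_good_and_restrictTo_mem_good σ a θ u₀ N Φ Ψ] with z hz
  exact hz.2 _

/-- The set of bad forecasts of `i` has `G_N`-measure zero. -/
theorem gibbs_not_forecastGood (σ a θ : ℝ) (u₀ : V3) (R : ℝ) (N : ℕ) (Φ : Flow σ N)
    (Ψ : ClusterFlows σ N) (i : Fin (N + 1)) :
    gibbs σ a θ u₀ N Φ {z | ¬ ForecastGood σ R N Ψ z i} = 0 :=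
  ae_iff.1 (ae_forecastGood σ a θ u₀ R N Φ Ψ i)

/-- Converse of the registered prelim: for `0 ≤ T` and ANY law `μ`, the probability of crowding
is at most that of a bad forecast plus that of gathering (`isGathering_iff_isCrowded`). -/
theorem measure_isCrowded_le (σ T R : ℝ) (N : ℕ) (Ψ : ClusterFlows σ N) (M : ℕ)
    (i : Fin (N + 1)) (μ : Measure (Phase N)) (hT : 0 ≤ T) :
    μ {z | IsCrowded σ T R N Ψ M z i} ≤
      μ {z | ¬ ForecastGood σ R N Ψ z i} + μ {z | IsGathering σ T R N Ψ M z i} := by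
  refine (measure_mono fun z hz => ?_).trans (measure_union_le _ _)
  by_cases hg : ForecastGood σ R N Ψ z i
  · exact Or.inr ((isGathering_iff_isCrowded hT hg).2 hz)
  · exact Or.inl hg

/-- **Gathering and crowding have the same `G_N`-probability** for `0 ≤ T` (they agree on good
forecasts, and bad forecasts are null). -/
theorem gibbs_isGathering_eq_isCrowded (σ a θ : ℝ) (u₀ : V3) (T R : ℝ) (N : ℕ) (Φ : Flow σ N)
    (Ψ : ClusterFlows σ N) (M : ℕ) (i : Fin (N + 1)) (hT : 0 ≤ T) :
    gibbs σ a θ u₀ N Φ {z | IsGathering σ T R N Ψ M z i} =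
      gibbs σ a θ u₀ N Φ {z | IsCrowded σ T R N Ψ M z i} := by
  apply le_antisymm
  · have h := stub_forecastCapsExist_prelim σ T R N Ψ M i (gibbs σ a θ u₀ N Φ) hT
    rwa [gibbs_not_forecastGood σ a θ u₀ R N Φ Ψ i, zero_add] at h
  · have h := measure_isCrowded_le σ T R N Ψ M i (gibbs σ a θ u₀ N Φ) hT
    rwa [gibbs_not_forecastGood σ a θ u₀ R N Φ Ψ i, zero_add] at h

/-- **The two tails agree schedule by schedule**: for `0 ≤ T` the gathering tail of the objects
module IS the grid-free cluster-cardinality tail of the prelim. -/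
theorem forecastGatheringTail_iff_clusterCardTail {σ a θ : ℝ} {u₀ : V3} {T : ℝ} {M : ℝ → ℕ}
    (hT : 0 ≤ T) : ForecastGatheringTail σ a θ u₀ T M ↔ ForecastClusterCardTail σ a θ u₀ T M := by
  unfold ForecastGatheringTail ForecastClusterCardTail
  simp_rw [gibbs_isGathering_eq_isCrowded _ _ _ _ _ _ _ _ _ _ _ hT]

/-! ## The canonical schedule `⌊√R⌋₊` and the equivalence -/

/-- An admissible schedule is eventually dominated by the canonical one `⌊√R⌋₊`, so its
cluster-cardinality tail implies the canonical one (crowding is antitone in the threshold). -/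
theorem forecastClusterCardTail_sqrt_of_admissible {σ a θ : ℝ} {u₀ : V3} {T : ℝ} {M : ℝ → ℕ}
    (hM : AdmissibleGathering M) (h : ForecastClusterCardTail σ a θ u₀ T M) :
    ForecastClusterCardTail σ a θ u₀ T fun R => ⌊Real.sqrt R⌋₊ := by
  obtain ⟨Rₐ, -, hRₐ⟩ := hM
  exact h.mono fun R hR => Nat.le_floor (hRₐ R hR).2

/-- **`ForecastCapsExist` is equivalent to the canonical cluster-cardinality tails** (its own
quantifier shell around `ForecastClusterCardTail σ a θ u₀ T ⌊√·⌋₊`; THE REMAINING GAP OF THE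
STUB, open, not asserted). Forward: an admissible genuine schedule gives the canonical tail
(`forecastGatheringTail_iff_clusterCardTail`, `forecastClusterCardTail_sqrt_of_admissible`);
backward: `⌊√R⌋₊` is admissible (`admissibleGathering_sqrt`) and its cardinality tail is its
gathering tail. -/
theorem forecastCapsExist_iff_sqrtClusterCardTail :
    ForecastCapsExist ↔
      ∀ (a θ : ℝ) (u₀ : V3), 0 < a → 0 < θ → ∃ σ₀ : ℝ, 0 < σ₀ ∧ ∀ σ : ℝ, 0 < σ → σ < σ₀ →
        ∀ T : ℝ, 0 < T → ForecastClusterCardTail σ a θ u₀ T fun R => ⌊Real.sqrt R⌋₊ := by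
  constructor
  · intro h a θ u₀ ha hθ
    obtain ⟨σ₀, hσ₀, hσ⟩ := h a θ u₀ ha hθ
    refine ⟨σ₀, hσ₀, fun σ hs hs' T hT => ?_⟩
    obtain ⟨M, hM, htail⟩ := hσ σ hs hs' T hT
    exact forecastClusterCardTail_sqrt_of_admissible hM
      ((forecastGatheringTail_iff_clusterCardTail hT.le).1 htail)
  · intro h a θ u₀ ha hθ
    obtain ⟨σ₀, hσ₀, hσ⟩ := h a θ u₀ ha hθ
    exact ⟨σ₀, hσ₀, fun σ hs hs' T hT => ⟨_, admissibleGathering_sqrt,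
      (forecastGatheringTail_iff_clusterCardTail hT.le).2 (hσ σ hs hs' T hT)⟩⟩

/-- **Named reduction of the stub**: the canonical cluster-cardinality tails (in the quantifier
shell of the stub) imply `ForecastCapsExist`. -/
theorem forecastCapsExist_of_clusterCardTail
    (h : ∀ (a θ : ℝ) (u₀ : V3), 0 < a → 0 < θ → ∃ σ₀ : ℝ, 0 < σ₀ ∧ ∀ σ : ℝ, 0 < σ → σ < σ₀ →
      ∀ T : ℝ, 0 < T → ForecastClusterCardTail σ a θ u₀ T fun R => ⌊Real.sqrt R⌋₊) :
    ForecastCapsExist :=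
  forecastCapsExist_iff_sqrtClusterCardTail.2 h

/-- Per-parameter form of the reduction (with `σ₀ = 1/2`): if for all `0 < σ < 1/2`, `a, θ, T > 0`
and `u₀` the canonical cluster-cardinality tail holds, then `ForecastCapsExist`. -/
theorem forecastCapsExist_of_clusterCardTail_half
    (h : ∀ (σ a θ : ℝ) (u₀ : V3) (T : ℝ), 0 < σ → σ < 1 / 2 → 0 < a → 0 < θ → 0 < T →
      ForecastClusterCardTail σ a θ u₀ T fun R => ⌊Real.sqrt R⌋₊) :
    ForecastCapsExist :=
  forecastCapsExist_of_clusterCardTail fun a θ u₀ ha hθ =>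
    ⟨1 / 2, one_half_pos, fun σ hs hs' T hT => h σ a θ u₀ T hs hs' ha hθ hT⟩

/-- Conversely, `ForecastCapsExist` forces the canonical tail at every admitted parameter. -/
theorem forecastClusterCardTail_sqrt_of_forecastCapsExist (h : ForecastCapsExist) {a θ : ℝ}
    (u₀ : V3) (ha : 0 < a) (hθ : 0 < θ) :
    ∃ σ₀ : ℝ, 0 < σ₀ ∧ ∀ σ : ℝ, 0 < σ → σ < σ₀ → ∀ T : ℝ, 0 < T →
      ForecastClusterCardTail σ a θ u₀ T fun R => ⌊Real.sqrt R⌋₊ :=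
  forecastCapsExist_iff_sqrtClusterCardTail.1 h a θ u₀ ha hθ

/-! ## The registered reduction stub -/

/-- **Registered sub-goal `stub_forecastCapsExist_reduction`** (stub `stub_forecastCapsExist` of
the line `slab-percolation-shadow`, crux stmt-AtomisticToContinuum-13916): `ForecastCapsExist`
is equivalent to its quantifier shell around the grid-free cluster-cardinality tail
`ForecastClusterCardTail σ a θ u₀ T ⌊√·⌋₊` of the prelim at the canonical schedule `⌊√R⌋₊` —
the remaining gap of the stub as ONE proposition without an existential over schedules. -/
theorem stub_forecastCapsExist_reduction : ForecastCapsExist ↔ ∀ (a θ : ℝ) (u₀ : V3), 0 < a → 0 < θ → ∃ σ₀ : ℝ, 0 < σ₀ ∧ ∀ σ : ℝ, 0 < σ → σ < σ₀ → ∀ T : ℝ, 0 < T → ForecastClusterCardTail σ a θ u₀ T fun R => ⌊Real.sqrt R⌋₊ :=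
  forecastCapsExist_iff_sqrtClusterCardTail

end

end Summit.AtomisticToContinuum.HydrodynamicLimit.Theorems.TrueAnchoredInfection
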